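import Mathlib
import Literature.NumberTheory.Automorphic.ResGLnCohomology
import Literature.NumberTheory.Automorphic.CuspidalCohomologyGLRankOneCharacter
import Literature.NumberTheory.Automorphic.ReciprocityGLnRankOneProofs
import Literature.NumberTheory.Automorphic.GLOneArchParameterOfAlgebraicCharacter
import Literature.NumberTheory.Automorphic.ClozelAlgebraicity
import Literature.NumberTheory.GaloisRepresentations.HeckeCharacterAutConj
import Literature.NumberTheory.GaloisRepresentations.AlgebraicHeckeCharacterGrossencharakterProofs
import Literature.Barriers.Langlands.NonRegularWeightBarrier
import HarnessLib

/-!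
# The finite part of the Hecke character of a cohomological `π` on `GL₁(𝔸_K)`
# (stub `stub_glOne_character` of line `Sketch`)

Crux `HeckeEigenvalueField` (stmt-Langlands-13632), automorphic half of the rank-one (`n = 1`)
case, over an ARBITRARY number field `K`, of the cuspidal-eigenclass fact on the carrier
`ResGLnCohomology.levelCohomology` — a convention check of that fact at `n = 1`.

Let `π = W / W'` be a cuspidal automorphic representation of `GL₁(𝔸_K)` (Borel–Jacquet datum) with
an infinity type `T` whose `a`-multisets are those of the cohomological type of `λ_τ^∨`
(`λ = (λ_τ)_{τ : K →+* ℂ}`, `λ_τ = lam τ 0`), i.e. `(T τ).map a = {-λ_τ}` (`ρ_{GL₁} = 0`,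
`λ^∨(0) = -λ(0)`), and with a `K(𝔫)`-fixed form `φ ∈ W ∖ W'`.  Let `χ_π` be the Hecke character of
`π` (`AutomorphicRepData.exists_heckeCharacter_glOne`: `r(g) φ ≡ χ_π(det g) φ mod W'`).  We produce
`χ := χ_π ∘ det ∘ (1, ·) : GL₁(𝔸_K^∞) → ℂˣ` and prove:

* (i) `χ` is trivial on `K_f(𝔫)` (the fixed form; `AutomorphicRepData.eq_of_sub_smul_mem`);
* (ii) for `γ ∈ GL₁(K)⁺` (totally positive), `χ(γ_f) = ∏_τ τ(γ)^{λ_τ}`: `T` is `C`-algebraic, so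
  `χ_π` has an infinity type `(p, q)` (`…exists_hasInfinityType_heckeCharacter_glOne`), whose
  embedding exponents are forced by the archimedean parameter of `π`
  (`…map_a_eq_of_hasInfinityType_heckeCharacter_glOne`: `(T τ).map a = {-n_τ}`), so `n_τ = λ_τ`;
  on the totally positive principal infinite idele `(γ)_∞`,
  `χ_π((γ)_∞) = ∏_τ τ(γ)^{-n_τ}` (`HeckeCharacter.HasInfinityType.apply_globalToInfiniteUnits_eq`,
  `HeckeCharacter.prod_embedding_zpow_eq`), and `(γ)_∞ · det(1, γ_f)` is the principal idele of
  `γ`, on which `χ_π` is trivial; hence `χ(γ_f) = χ_π((γ)_∞)⁻¹ = ∏_τ τ(γ)^{λ_τ}`;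
* (iii) `χ(t_{v,i})` is the Satake–Tamagawa eigenvalue `heckeEigenvalueOf 1 v α i` for `v ∤ 𝔫`
  (`AutomorphicRepData.quasiCharacter_heckeElement_eq_of_hasSatakeParamAt`).

[cite: Clozel1990, §1.1 and §3.3 (n = 1)]
-/

set_option linter.dupNamespace false -- project-wide: Summit.Langlands.Langlands is the mandated namespace

noncomputable section

open scoped Classical ComplexConjugate
open NumberField IsDedekindDomain Literature.NumberTheory.Automorphic
  Literature.NumberTheory.GaloisRepresentations Literature.NumberTheory.DiophantineGeometry
  Literature.Barriers.Langlands ResGLnCohomology BigHeckeGLn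

namespace Summit.Langlands.Langlands.Theorems.HeckeEigenvalueField.Res

/-! ## The archimedean side: the exponents of the Hecke character -/

/-- For `n = 1` the `a`-multiset of the cohomological infinity type of `μ` is `{μ₀}`
(`ρ_{GL₁} = 0`). [folklore] -/
private theorem map_a_cohomologicalInfinityType_one {K : Type} [Field K] (μ : Fin 1 → ℤ)
    (τ : K →+* ℂ) :
    (cohomologicalInfinityType 1 K μ τ).map ArchWeight.a = {((μ 0 : ℤ) : ℂ)} := by
  rw [cohomologicalInfinityType_apply, Finset.univ_unique, Fin.default_eq_zero, Finset.singleton_val,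
    Multiset.map_singleton, Multiset.map_singleton, cohomologicalArchWeight_a, rhoGL_one, add_zero]

/-- `λ^∨(0) = -λ(0)` for a weight of `GL₁`. [folklore] -/
private theorem weight_dual_zero_one (μ : Fin 1 → ℤ) : Weight.dual μ 0 = -μ 0 := by
  show -μ (Fin.rev 0) = -μ 0
  rw [Subsingleton.elim (Fin.rev 0 : Fin 1) 0]

/-- A well-formed infinity type `T` of `GL₁` whose `a`-multisets are singletons of integers,
`(T τ).map a = {m_τ}`, is `C`-algebraic: its weight at `τ` is `(m_τ, m_{τ̄})` (the `b`-exponent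
is the `a`-exponent at the conjugate embedding, by compatibility with complex conjugation).
[folklore] -/
private theorem isCAlgebraic_of_map_a_eq_singleton {K : Type} [Field K] {T : InfinityType K 1}
    (hTwf : T.IsWellFormed) (m : (K →+* ℂ) → ℤ)
    (hk : ∀ τ : K →+* ℂ, (T τ).map ArchWeight.a = {((m τ : ℤ) : ℂ)}) : T.IsCAlgebraic := by
  intro σ w hw
  obtain ⟨w₀, hw₀⟩ := Multiset.card_eq_one.1 (hTwf.1 σ)
  rw [hw₀, Multiset.mem_singleton] at hw
  subst hw
  have ha : w.a = ((m σ : ℤ) : ℂ) := by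
    have h := hk σ
    rw [hw₀, Multiset.map_singleton] at h
    exact Multiset.singleton_inj.1 h
  have hb : w.b = ((m (ComplexEmbedding.conjugate σ) : ℤ) : ℂ) := by
    have h := hk (ComplexEmbedding.conjugate σ)
    rw [hTwf.2 σ, hw₀, Multiset.map_singleton, Multiset.map_singleton, ArchWeight.swap_a] at h
    exact Multiset.singleton_inj.1 h
  refine ⟨m σ, m (ComplexEmbedding.conjugate σ), ?_, ?_⟩
  · rw [ha]; push_cast; ring
  · rw [hb]; push_cast; ring

/-- **The exponents of the Hecke character of `π` are read off the archimedean parameter.**  If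
`π = W / W'` on `GL₁(𝔸_K)` has Hecke character `χ` and an infinity type `T` with
`(T τ).map a = {m_τ}`, `m_τ ∈ ℤ`, then `χ` has an infinity type `(p, q)`
(`exists_hasInfinityType_heckeCharacter_glOne`, `T` being `C`-algebraic) and its embedding
exponents are `n_τ = -m_τ` (`map_a_eq_of_hasInfinityType_heckeCharacter_glOne`: every infinity
type of `π` has `a`-multiset `{-n_τ}` at `τ`). [cite: Clozel1990, §3.3 (n = 1)] -/
private theorem exists_hasInfinityType_embExponent_eq {K : Type} [Field K] [NumberField K]
    {hcpt : isCompact_glFiniteIntegralLevel 1 K}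
    (π : AutomorphicRepData (AutomorphyDatum.gl 1 K hcpt)) {χ : HeckeCharacter K}
    (hχ : ∀ (g : (AdelicGroupData.gl 1 K).Adelic), ∀ φ ∈ π.W,
      rightTranslation (AdelicGroupData.gl 1 K) g φ -
        ((χ (Matrix.GeneralLinearGroup.det g) : ℂˣ) : ℂ) • φ ∈ π.W')
    {T : InfinityType K 1} (hT : π.HasInfinityType T) (m : (K →+* ℂ) → ℤ)
    (hk : ∀ τ : K →+* ℂ, (T τ).map ArchWeight.a = {((m τ : ℤ) : ℂ)}) :
    ∃ p q : InfinitePlace K → ℤ, χ.HasInfinityType p q ∧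
      ∀ τ : K →+* ℂ, HeckeCharacter.embExponent p q τ = -m τ := by
  obtain ⟨p, q, hpq⟩ := π.exists_hasInfinityType_heckeCharacter_glOne hχ hT
    (isCAlgebraic_of_map_a_eq_singleton hT.1 m hk)
  refine ⟨p, q, hpq, fun τ => ?_⟩
  have h1 := π.map_a_eq_of_hasInfinityType_heckeCharacter_glOne hχ hpq hT τ
  rw [hk τ, Multiset.singleton_inj] at h1
  have h2 : ((-m τ : ℤ) : ℂ) = ((HeckeCharacter.embExponent p q τ : ℤ) : ℂ) := by
    rw [Int.cast_neg, h1, neg_neg]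
  exact_mod_cast h2.symm

/-! ## The principal idele of `det γ` and the value `χ(det (1, γ_f))` -/

/-- For `γ ∈ GL₁(K)` with `k = det γ`: `(k)_∞ · det (1, ι(γ)) = (k)` as ideles (`ι` the diagonal
embedding into `GL₁(𝔸_K^∞)`, `(1, ·) = GLn.ofFinite`). [folklore] -/
private theorem infiniteIdeles_mul_det_ofFinite_globalEmbedding {K : Type} [Field K] [NumberField K]
    (γ : GL (Fin 1) K) :
    infiniteIdeles K (globalToInfiniteUnits K (Matrix.GeneralLinearGroup.det γ)) *
        Matrix.GeneralLinearGroup.det (GLn.ofFinite 1 K (globalEmbedding 1 K γ)) =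
      Literature.NumberTheory.GaloisRepresentations.principalIdele K
        (Matrix.GeneralLinearGroup.det γ) := by
  refine Units.ext (Prod.ext ?_ ?_)
  · -- infinite component: `(k)_∞ · 1 = (k)_∞`
    rw [ideleGroup_val_fst_mul, infiniteIdeles_fst, val_globalToInfiniteUnits, principalIdele_fst,
      Matrix.GeneralLinearGroup.val_det_apply (GLn.ofFinite 1 K (globalEmbedding 1 K γ)),
      Matrix.det_fin_one, GLn.coe_ofFinite_apply]
    show _ * (1 : Matrix (Fin 1) (Fin 1) (InfiniteAdeleRing K)) 0 0 = _
    rw [Matrix.one_apply_eq, mul_one]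
  · -- finite component: `1 · ι(γ)₀₀ = k`
    show (1 : FiniteAdeleRing (𝓞 K) K) *
        ((Matrix.GeneralLinearGroup.det (GLn.ofFinite 1 K (globalEmbedding 1 K γ)) : ideleGroup K) :
          AdeleRing (𝓞 K) K).2 =
      algebraMap K (FiniteAdeleRing (𝓞 K) K) ((Matrix.GeneralLinearGroup.det γ : Kˣ) : K)
    rw [one_mul, Matrix.GeneralLinearGroup.val_det_apply (GLn.ofFinite 1 K (globalEmbedding 1 K γ)),
      Matrix.det_fin_one, GLn.coe_ofFinite_apply]
    show algebraMap K (FiniteAdeleRing (𝓞 K) K) ((γ : Matrix (Fin 1) (Fin 1) K) 0 0) = _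
    congr 1
    rw [Matrix.GeneralLinearGroup.val_det_apply, Matrix.det_fin_one]

/-- **`χ(det (1, γ_f)) = ∏_τ τ(det γ)^{n_τ}` for `γ ∈ GL₁(K)⁺`** when the Hecke character `χ` has
infinity type `(p, q)` with embedding exponents `n_τ`: `χ` is trivial on the principal idele
`(k) = (k)_∞ · det(1, γ_f)` (`k = det γ`), and on the totally positive `(k)_∞` it is
`∏_τ τ(k)^{-n_τ}` (`HasInfinityType.apply_globalToInfiniteUnits_eq`, `prod_embedding_zpow_eq`).
[cite: Clozel1990, §1.1 (n = 1)] -/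
private theorem heckeCharacter_det_ofFinite_globalEmbedding_eq {K : Type} [Field K] [NumberField K]
    {χ : HeckeCharacter K} {p q : InfinitePlace K → ℤ} (hpq : χ.HasInfinityType p q)
    (γ : GL (Fin 1) K)
    (hpos : ∀ φ : K →+* ℝ, 0 < φ ((Matrix.GeneralLinearGroup.det γ : Kˣ) : K)) :
    ((χ (Matrix.GeneralLinearGroup.det (GLn.ofFinite 1 K (globalEmbedding 1 K γ))) : ℂˣ) : ℂ) =
      ∏ τ : K →+* ℂ, (τ ((Matrix.GeneralLinearGroup.det γ : Kˣ) : K)) ^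
        (HeckeCharacter.embExponent p q τ) := by
  have hmul : ((χ (infiniteIdeles K (globalToInfiniteUnits K (Matrix.GeneralLinearGroup.det γ))) :
      ℂˣ) : ℂ) *
      ((χ (Matrix.GeneralLinearGroup.det (GLn.ofFinite 1 K (globalEmbedding 1 K γ))) : ℂˣ) : ℂ) =
        1 := by
    rw [← Units.val_mul, ← map_mul, infiniteIdeles_mul_det_ofFinite_globalEmbedding γ,
      χ.map_principal (Literature.NumberTheory.GaloisRepresentations.principalIdele_mem _),
      Units.val_one]
  have hinf : ((χ (infiniteIdeles K (globalToInfiniteUnits K (Matrix.GeneralLinearGroup.det γ))) :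
      ℂˣ) : ℂ) =
      ∏ τ : K →+* ℂ, (τ ((Matrix.GeneralLinearGroup.det γ : Kˣ) : K)) ^
        (-HeckeCharacter.embExponent p q τ) := by
    rw [hpq.apply_globalToInfiniteUnits_eq hpos,
      HeckeCharacter.prod_embedding_zpow_eq p q (Matrix.GeneralLinearGroup.det γ).ne_zero]
  rw [eq_inv_of_mul_eq_one_right hmul, hinf, ← Finset.prod_inv_distrib]
  refine Finset.prod_congr rfl fun τ _ => ?_
  rw [zpow_neg, inv_inv]

/-! ## The stub -/

/-- **Stub A1 (automorphic side, rank one)** — the finite part of the Hecke character of a cuspidal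
`π` on `GL₁(𝔸_K)` of cohomological type `λ^∨` with a `K(𝔫)`-fixed form: a character `χ` of
`GL₁(𝔸_K^∞)` trivial on `K_f(𝔫)`, equal to `∏_τ τ(γ)^{λ_τ}` on `γ ∈ GL₁(K)⁺` (the Hecke character is
trivial on principal ideles and is `∏_τ τ(·)^{-λ_τ}` on totally positive infinite ideles,
`AutomorphicRepData.exists_heckeCharacter_glOne`,
`AutomorphicRepData.exists_hasInfinityType_heckeCharacter_glOne`,
`AutomorphicRepData.map_a_eq_of_hasInfinityType_heckeCharacter_glOne`,
`HeckeCharacter.HasInfinityType.apply_globalToInfiniteUnits_eq`), whose values at the `t_{v,i}`,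
`v ∤ 𝔫`, are the Satake–Tamagawa eigenvalues (`quasiCharacter_heckeElement_eq_of_hasSatakeParamAt`).
[cite: Clozel1990, §1.1 and §3.3 (n = 1)] -/
theorem stub_glOne_character :
    ∀ (K : Type) [Field K] [NumberField K] (hcpt : isCompact_glFiniteIntegralLevel 1 K)
      (𝔫 : Ideal (𝓞 K)) (lam : (K →+* ℂ) → Fin 1 → ℤ), 𝔫 ≠ 0 →
      ∀ π : CuspidalAutomorphicRepData 1 K hcpt,
        (∃ T : InfinityType K 1, π.1.HasInfinityType T ∧
          ∀ τ : K →+* ℂ, (T τ).map ArchWeight.a =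
            (cohomologicalInfinityType 1 K (Weight.dual (lam τ)) τ).map ArchWeight.a) →
        (∃ φ ∈ π.1.W, φ ∉ π.1.W' ∧
          ∀ u ∈ principalCongruenceLevel 1 K 𝔫, rightTranslation (AdelicGroupData.gl 1 K) u φ = φ) →
        ∃ χ : FiniteAdelicGL 1 K →* ℂˣ,
          (∀ u ∈ level 1 K 𝔫, χ u = 1) ∧
          (∀ γ : glTotPos 1 K, ((χ (diagPos 1 K γ) : ℂˣ) : ℂ) =
            ∏ τ : K →+* ℂ,
              (τ ((Matrix.GeneralLinearGroup.det (γ : GL (Fin 1) K) : Kˣ) : K)) ^ (lam τ 0)) ∧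
          ∀ v : HeightOneSpectrum (𝓞 K), ¬ v.asIdeal ∣ 𝔫 → ∀ α : Multiset ℂ,
            π.1.HasSatakeParamAt v α → ∀ i ≤ 1,
              ((χ (heckeElement 1 K v i) : ℂˣ) : ℂ) = heckeEigenvalueOf 1 v α i := by
  intro K _ _ hcpt 𝔫 lam h𝔫 π hT hfix
  obtain ⟨T, hT, hTa⟩ := hT
  obtain ⟨φ, hφW, hφW', hφfix⟩ := hfix
  -- the Hecke character of `π` and the quasi-character `ω = χ_π ∘ det` of `GL₁(𝔸_K)`
  obtain ⟨χH, hχH⟩ := π.1.exists_heckeCharacter_glOne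
  let ω : (AdelicGroupData.gl 1 K).Adelic →* ℂˣ :=
    (χH : ideleGroup K →* ℂˣ).comp
      (Matrix.GeneralLinearGroup.det : GL (Fin 1) (AdeleRing (𝓞 K) K) →* (AdeleRing (𝓞 K) K)ˣ)
  have hω : ∀ (g : (AdelicGroupData.gl 1 K).Adelic), ∀ ψ ∈ π.1.W,
      rightTranslation (AdelicGroupData.gl 1 K) g ψ - ((ω g : ℂˣ) : ℂ) • ψ ∈ π.1.W' :=
    fun g ψ hψ => hχH g ψ hψ
  -- `ω` is trivial on `K(𝔫)` (the fixed form `φ`)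
  have hωK : ∀ u ∈ principalCongruenceLevel 1 K 𝔫,
      ω (show (AdelicGroupData.gl 1 K).Adelic from u) = 1 := by
    intro u hu
    have h := π.1.eq_of_sub_smul_mem (hω (show (AdelicGroupData.gl 1 K).Adelic from u)) hφW hφW'
      (b := 1) (by rw [hφfix u hu, one_smul, sub_self]; exact π.1.W'.zero_mem)
    exact Units.val_eq_one.mp h
  -- the archimedean exponents: `(T τ).map a = {-λ_τ}`, so `n_τ = λ_τ`
  have hk : ∀ τ : K →+* ℂ, (T τ).map ArchWeight.a = {((-(lam τ 0) : ℤ) : ℂ)} := by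
    intro τ
    rw [hTa τ, map_a_cohomologicalInfinityType_one, weight_dual_zero_one]
  obtain ⟨p, q, hpq, hemb⟩ :=
    exists_hasInfinityType_embExponent_eq π.1 hχH hT (fun τ => -(lam τ 0)) hk
  -- the finite part `χ = ω ∘ (1, ·)`
  refine ⟨ω.comp (GLn.ofFinite 1 K), fun u hu => hωK _ (mem_finitePrincipalCongruenceLevel_iff.mp hu),
    fun γ => ?_, fun v hv α hα i hi => ?_⟩
  · -- (ii) `χ(γ_f) = ∏_τ τ(det γ)^{λ_τ}` on `GL₁(K)⁺`
    have hpos : ∀ φ : K →+* ℝ,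
        0 < φ ((Matrix.GeneralLinearGroup.det (γ : GL (Fin 1) K) : Kˣ) : K) :=
      (mem_glTotPos_iff _).1 γ.2
    have h := heckeCharacter_det_ofFinite_globalEmbedding_eq hpq (γ : GL (Fin 1) K) hpos
    refine h.trans (Finset.prod_congr rfl fun τ _ => ?_)
    rw [hemb τ, neg_neg]
  · -- (iii) the Satake–Tamagawa eigenvalues at the Hecke elements
    exact π.1.quasiCharacter_heckeElement_eq_of_hasSatakeParamAt hω h𝔫 hωK hv hα hi

end Summit.Langlands.Langlands.Theorems.HeckeEigenvalueField.Res

end
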